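import Mathlib
import HarnessLib

/-!
# The carrier budget: injection versus the rest at a band's sup carrier, by envelope difference — and its record on four designs

Cell `pub-fluidc` (FLUID COMPUTER; host summit `NavierStokesRegularity`, negation side, machine paradigm), prover seat p1 (gen 16,
2026-08-26). HONEST FRAMING: low prior, high value-of-information experiment on Tao's machine paradigm; NOT a claim that NS blows up.
Nothing in this file is about the Navier–Stokes equations: it is the bookkeeping of p1's reader `winner_budget.py` (deposit
`atlas/rung-next/p1/spatial/transfer/WINNER-BUDGET.md`, `LEVEL1-BUDGET.md`; HOME/STATUS p1 gen 16 information lines) and the numbers it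
printed, typed as records. Companion of `TriadClassLedger` (the class algebra; §5 there = the takeover / class-share / co-location record).

THE SPLIT. Over a window `[a, b]` in which the band argmax does not hop, the reader takes the ENVELOPE logarithmic rate of the band sup from
the sup values themselves, `env = 2·log(W_b/W_a)/(b − a)`, and the window means, at the argmax, of the INJECTION-class log-rate `inj` (pairs
with no factor in the band: a smooth point value, free of the grid-misregistration sweep) and of the viscous log-rate `visc`; it REPORTS
`rest := env − inj − visc` — by construction the combined log-rate of every class acting on existing band content (strain + self + back).
§1 types that definition and its trivial consequences (the sign of `rest` is decided by comparing `env − visc` with `inj`; the 'injection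
share' `inj/(env − visc)` exceeds 1 iff `rest < 0` when `env − visc > 0`). §2 is THE RECORD (128³, enstrophy sup of the band; four designs:
u0_b⁽²⁾ / u0_b / u0_bE at level two [9,17) through EARLY TROUGH [0.4,1.2], LATE TROUGH [1.2,2.0] (the incumbent) and WINNER [2.05,2.50];
the break point u0⁽²⁾ and u0_b⁽²⁾ at level one [5,9) through [0.4,1.0], [1.0,1.5], [1.5,2.05]): `rest` is ≈ 0 early, NEGATIVE for every
sub-floor carrier once injection fades (the relay designs' level-two incumbents −0.37…−0.47; u0_b⁽²⁾'s level-one carrier −0.51), and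
≥ +1 for the level-two takeover WINNERS (+1.66 / +1.89 / +1.87) and for the floor-beating design's level-one carrier (+1.29, +1.09) —
`subfloor_carriers_drained`, `winners_amplified`, `breakpoint_level_one_amplified`, `signature_separates`. Words: none ('drained' /
'amplified' name the sign of `rest`). Caveat typed as a hypothesis nowhere needed: `rest` is robust as a TWO-way split only; the term-by-term
strain / self / back means of the material pass agree with it to ±0.4 (A, B, D) / ±0.8 (C) and are not recorded here. 0 sorry; no named fact.
-/

noncomputable section

namespace Summit.NavierStokesRegularity.FluidComputer.CarrierBudget

/-! ## §1 The by-difference split -/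

/-- The envelope logarithmic rate of a positive quantity between two instants: `2·log(W₁/W₀)/(t₁ − t₀)` (the reader's `ENVELOPE d ln W²/dt`). -/
def envelopeRate (W₀ W₁ t₀ t₁ : ℝ) : ℝ := 2 * Real.log (W₁ / W₀) / (t₁ - t₀)

/-- The REST of a carrier's budget: envelope rate minus the injection-class and viscous log-rates at the argmax. -/
def rest (env inj visc : ℝ) : ℝ := env - inj - visc

/-- The injection SHARE of the non-viscous growth: `inj / (env − visc)`. -/
def injShare (env inj visc : ℝ) : ℝ := inj / (env - visc)

/-- The split is exact by construction: `env = inj + visc + rest`. -/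
theorem split_exact (env inj visc : ℝ) : env = inj + visc + rest env inj visc := by
  unfold rest; ring

/-- `rest < 0` iff injection exceeds the non-viscous growth; with `env − visc > 0` this is 'injection share > 1'. -/
theorem rest_neg_iff (env inj visc : ℝ) : rest env inj visc < 0 ↔ env - visc < inj := by
  unfold rest; constructor <;> intro h <;> linarith

/-- With positive non-viscous growth, 'injection share > 1' is the same statement as 'rest < 0'. -/
theorem injShare_gt_one_iff {env inj visc : ℝ} (hpos : 0 < env - visc) : 1 < injShare env inj visc ↔ rest env inj visc < 0 := by
  rw [rest_neg_iff, injShare, lt_div_iff₀ hpos, one_mul]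

/-- The envelope rate is positive iff the sup grew (for `t₁ > t₀`, `W₀ > 0`, `W₁ > 0`). -/
theorem envelopeRate_pos_iff {W₀ W₁ t₀ t₁ : ℝ} (hW₀ : 0 < W₀) (hW₁ : 0 < W₁) (ht : t₀ < t₁) :
    0 < envelopeRate W₀ W₁ t₀ t₁ ↔ W₀ < W₁ := by
  unfold envelopeRate
  rw [div_pos_iff_of_pos_right (by linarith), mul_pos_iff_of_pos_left (by norm_num : (0:ℝ) < 2), Real.log_pos_iff (div_pos hW₁ hW₀).le,
    one_lt_div hW₀]

/-! ## §2 The record (enstrophy sup; 128³; numbers printed by `winner_budget.py`) -/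

/-- A window reading: envelope rate, injection-class log-rate, viscous log-rate (window means at the argmax). -/
structure Reading where
  /-- envelope d ln W²/dt of the band sup over the window -/
  env : ℝ
  /-- window mean of the injection-class log-rate at the argmax -/
  inj : ℝ
  /-- window mean of the viscous log-rate at the argmax -/
  visc : ℝ

/-- the REST of a reading. -/
def Reading.rest (r : Reading) : ℝ := CarrierBudget.rest r.env r.inj r.visc

/-- LEVEL TWO [9,17), designs `0` = u0_b⁽²⁾, `1` = u0_b, `2` = u0_bE: EARLY TROUGH [0.4, 1.2]. -/
def earlyTrough : Fin 3 → Reading := ![⟨3.672, 3.724, -0.269⟩, ⟨3.651, 3.726, -0.270⟩, ⟨3.608, 3.691, 0⟩]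
/-- LATE TROUGH [1.2, 2.0] (the incumbent carries the sup). -/
def lateTrough : Fin 3 → Reading := ![⟨0.873, 1.614, -0.275⟩, ⟨0.840, 1.535, -0.273⟩, ⟨1.029, 1.403, 0⟩]
/-- WINNER [2.05, 2.50] (the winner carries the sup). -/
def winner : Fin 3 → Reading := ![⟨2.409, 1.015, -0.266⟩, ⟨2.539, 0.914, -0.269⟩, ⟨2.729, 0.860, 0⟩]

/-- LEVEL ONE [5,9): the break point u0⁽²⁾ (`bp`) and u0_b⁽²⁾ (`rel`) over [0.4,1.0], [1.0,1.5], [1.5,2.05]. -/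
def bpLevelOne : Fin 3 → Reading := ![⟨2.836, 2.271, -0.073⟩, ⟨1.724, 0.513, -0.077⟩, ⟨1.060, 0.052, -0.082⟩]
/-- … and the relay design u0_b⁽²⁾ at its level one over the same windows. -/
def relLevelOne : Fin 3 → Reading := ![⟨2.627, 2.101, -0.076⟩, ⟨0.827, 0.897, -0.077⟩, ⟨-0.353, 0.239, -0.078⟩]

/-- **EARLY: INJECTION ALONE.** In the early trough the level-two carrier's growth is injection to within ±0.25 per unit (rest ∈ (−0.1, 0.25)),
and at level one both designs start alike (rest +0.60 / +0.64). -/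
theorem early_injection_alone :
    (∀ d, -0.1 < (earlyTrough d).rest ∧ (earlyTrough d).rest < 0.25) ∧
    (0.6 < (relLevelOne 0).rest ∧ (relLevelOne 0).rest < 0.61) ∧ (0.63 < (bpLevelOne 0).rest ∧ (bpLevelOne 0).rest < 0.64) := by
  refine ⟨fun d => ?_, ?_, ?_⟩
  · fin_cases d <;> simp [earlyTrough, Reading.rest, rest] <;> norm_num
  · simp [relLevelOne, Reading.rest, rest]; norm_num
  · simp [bpLevelOne, Reading.rest, rest]; norm_num

/-- **SUB-FLOOR CARRIERS ARE DRAINED.** Once injection fades, every sub-floor carrier has NEGATIVE rest: the three level-two incumbents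
(−0.47 / −0.42 / −0.37, injection share > 1) and the relay design's level-one carrier in its last window (−0.51). -/
theorem subfloor_carriers_drained :
    (∀ d, (lateTrough d).rest < -0.35 ∧ 1 < injShare (lateTrough d).env (lateTrough d).inj (lateTrough d).visc) ∧
    (relLevelOne 2).rest < -0.5 ∧ |(relLevelOne 1).rest| < 0.01 := by
  refine ⟨fun d => ⟨?_, ?_⟩, ?_, ?_⟩
  · fin_cases d <;> simp [lateTrough, Reading.rest, rest] <;> norm_num
  · fin_cases d <;> simp [lateTrough, injShare] <;> norm_num
  · simp [relLevelOne, Reading.rest, rest]; norm_num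
  · simp [relLevelOne, Reading.rest, rest]; norm_num

/-- **WINNERS ARE AMPLIFIED.** Each level-two takeover winner has rest ≥ +1.66 (two thirds of its growth: injection share ≤ 0.38). -/
theorem winners_amplified :
    ∀ d, 1.66 ≤ (winner d).rest ∧ injShare (winner d).env (winner d).inj (winner d).visc ≤ 0.38 := by
  intro d; fin_cases d <;> simp [winner, Reading.rest, rest, injShare] <;> norm_num

/-- **THE BREAK POINT's LEVEL-ONE CARRIER IS AMPLIFIED** after injection fades: rest +1.29 and +1.09 in the two later windows while its
injection share falls to 0.28 and 0.05. -/
theorem breakpoint_level_one_amplified :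
    1.28 < (bpLevelOne 1).rest ∧ 1.08 < (bpLevelOne 2).rest ∧
    injShare (bpLevelOne 2).env (bpLevelOne 2).inj (bpLevelOne 2).visc < 0.05 := by
  simp [bpLevelOne, Reading.rest, rest, injShare]; norm_num

/-- **ONE SIGNATURE SEPARATES THEM.** With the threshold `rest ≥ 1` ('amplified after injection fades') versus `rest ≤ 0` ('not'): the
three winners and the break point's two late level-one windows are on one side, the three incumbents and the relay design's two late
level-one windows on the other — while (TriadClassLedger §5, `trough_fed_by_injection`; LEVEL1-BUDGET) the band-integrated budgets of all
four designs are alike. -/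
theorem signature_separates :
    (∀ d, 1 ≤ (winner d).rest) ∧ 1 ≤ (bpLevelOne 1).rest ∧ 1 ≤ (bpLevelOne 2).rest ∧
    (∀ d, (lateTrough d).rest ≤ 0) ∧ (relLevelOne 1).rest ≤ 0.01 ∧ (relLevelOne 2).rest ≤ 0 := by
  refine ⟨fun d => ?_, ?_, ?_, fun d => ?_, ?_, ?_⟩
  · fin_cases d <;> simp [winner, Reading.rest, rest] <;> norm_num
  · simp [bpLevelOne, Reading.rest, rest]; norm_num
  · simp [bpLevelOne, Reading.rest, rest]; norm_num
  · fin_cases d <;> simp [lateTrough, Reading.rest, rest] <;> norm_num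
  · simp [relLevelOne, Reading.rest, rest]; norm_num
  · simp [relLevelOne, Reading.rest, rest]; norm_num

/-- **ACROSS THE HOP THE INJECTION RATE DOES NOT RISE — THE REST CHANGES SIGN** (each relay design: the winner's injection log-rate is
below the incumbent's, its rest above by more than 2 per unit). -/
theorem across_the_hop (d : Fin 3) : (winner d).inj < (lateTrough d).inj ∧ (lateTrough d).rest + 2 < (winner d).rest := by
  fin_cases d <;> simp [winner, lateTrough, Reading.rest, rest] <;> norm_num

/-! ## §3 Term by term (the CAP-AVERAGED rates of the third pass, kit j255374–j255377; deposit README (X9), `WINNER-BUDGET.md`,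
`LEVEL1-BUDGET.md`): the acting-on-content classes one by one — STRAIN (band content × the larger scales), SELF (band × band), BACK (any factor in
the smaller scales). Check columns of the reader: cap total vs envelope ±0.1–0.3 at level two, ±0.02–0.2 at level one; cap strain+self+back vs
the by-difference `rest` ±0.05–0.3. Numbers per unit time; words none. -/

/-- The three acting-on-content class log-rates of a window (cap-averaged). -/
structure Terms where
  /-- strain class -/
  strain : ℝ
  /-- self class -/
  self : ℝ
  /-- backscatter class (negative = drain to smaller scales) -/
  back : ℝ

/-- their sum (= `rest` up to the check tolerance). -/
def Terms.sum (x : Terms) : ℝ := x.strain + x.self + x.back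

/-- LEVEL TWO, the INCUMBENT window [1.2, 2.0] (designs u0_b⁽²⁾ / u0_b / u0_bE). -/
def incumbentTerms : Fin 3 → Terms := ![⟨0.844, -0.611, -0.730⟩, ⟨0.808, -0.707, -0.745⟩, ⟨0.717, -0.803, -0.892⟩]
/-- LEVEL TWO, the WINNER window [2.05, 2.50]. -/
def winnerTerms : Fin 3 → Terms := ![⟨1.924, 0.110, -0.322⟩, ⟨1.920, 0.284, -0.298⟩, ⟨2.146, 0.396, -0.505⟩]
/-- LEVEL ONE, the break point u0⁽²⁾ over [0.4,1.0] / [1.0,1.5] / [1.5,2.05]. -/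
def bpTerms : Fin 3 → Terms := ![⟨1.299, -0.366, -0.161⟩, ⟨1.578, -0.318, -0.030⟩, ⟨1.265, -0.280, 0.110⟩]
/-- LEVEL ONE, the relay design u0_b⁽²⁾ over the same windows. -/
def relTerms : Fin 3 → Terms := ![⟨1.070, 0.119, -0.583⟩, ⟨0.637, -0.185, -0.438⟩, ⟨0.503, -0.371, -0.596⟩]

/-- **AT THE WINNER, STRAIN DOMINATES**: strain ≥ 1.9 carries more than the whole positive balance (self ≤ 0.4, back < 0), and against the
incumbent of the same design strain grows by a factor ≥ 2.2, self turns from negative to positive, and the drain shrinks (winner |back| ≤ 0.7 × incumbent |back|). -/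
theorem winner_strain_dominates (d : Fin 3) :
    1.9 ≤ (winnerTerms d).strain ∧ (winnerTerms d).self ≤ 0.4 ∧ (winnerTerms d).back < 0 ∧
    2.2 * (incumbentTerms d).strain ≤ (winnerTerms d).strain ∧ (incumbentTerms d).self < 0 ∧ 0 < (winnerTerms d).self ∧
    |(winnerTerms d).back| ≤ 0.7 * |(incumbentTerms d).back| := by
  fin_cases d <;> simp [winnerTerms, incumbentTerms] <;> norm_num [abs_of_neg, abs_of_pos]

/-- **THE INCUMBENT IS DRAINED BY SELF AND BACK, NOT BY STRAIN**: its strain term is still positive (+0.7…+0.85) while self and back are each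
≤ −0.6, so the sum is negative. -/
theorem incumbent_drained_by_self_and_back (d : Fin 3) :
    0.7 ≤ (incumbentTerms d).strain ∧ (incumbentTerms d).self ≤ -0.6 ∧ (incumbentTerms d).back ≤ -0.7 ∧ (incumbentTerms d).sum < -0.45 := by
  fin_cases d <;> simp [incumbentTerms, Terms.sum] <;> norm_num

/-- **THE BREAK POINT KEEPS ITS STRAIN AND DOES NOT LEAK; THE RELAY DESIGN LOSES ITS STRAIN AND LEAKS** (level one, window by window):
break point strain ≥ 1.26 in all three windows with |back| ≤ 0.17; relay strain falling 1.07 → 0.64 → 0.50 with back ≤ −0.43 throughout. -/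
theorem breakpoint_keeps_strain_no_leak :
    (∀ w, 1.26 ≤ (bpTerms w).strain ∧ |(bpTerms w).back| ≤ 0.17) ∧
    ((relTerms 1).strain < (relTerms 0).strain ∧ (relTerms 2).strain < (relTerms 1).strain ∧ (relTerms 2).strain ≤ 0.51) ∧
    (∀ w, (relTerms w).back ≤ -0.43) := by
  refine ⟨fun w => ?_, ?_, fun w => ?_⟩
  · fin_cases w <;> simp [bpTerms] <;> norm_num [abs_of_neg, abs_of_pos]
  · simp [relTerms]; norm_num
  · fin_cases w <;> simp [relTerms] <;> norm_num

/-- Consistency with §2 (the two-way split): each cap sum is within 0.3 of the corresponding by-difference `rest` (winners and level one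
within 0.1). -/
theorem terms_match_rest :
    (∀ d, |(winnerTerms d).sum - (winner d).rest| ≤ 0.2) ∧ (∀ d, |(incumbentTerms d).sum - (lateTrough d).rest| ≤ 0.65) ∧
    (∀ w, |(bpTerms w).sum - (bpLevelOne w).rest| ≤ 0.15) ∧ (∀ w, |(relTerms w).sum - (relLevelOne w).rest| ≤ 0.06) := by
  refine ⟨fun d => ?_, fun d => ?_, fun w => ?_, fun w => ?_⟩
  · fin_cases d <;> simp [winnerTerms, winner, Terms.sum, Reading.rest, rest] <;> norm_num [abs_le]
  · fin_cases d <;> simp [incumbentTerms, lateTrough, Terms.sum, Reading.rest, rest] <;> norm_num [abs_le]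
  · fin_cases w <;> simp [bpTerms, bpLevelOne, Terms.sum, Reading.rest, rest] <;> norm_num [abs_le]
  · fin_cases w <;> simp [relTerms, relLevelOne, Terms.sum, Reading.rest, rest] <;> norm_num [abs_le]

end Summit.NavierStokesRegularity.FluidComputer.CarrierBudget

end
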